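import Mathlib
import Literature.Analysis.FluidPDE.HardSphereCollisionRecord
import Literature.Analysis.FluidPDE.HardSphereTorusMeasure
import Literature.Analysis.FluidPDE.HardSphereRegularGeometry
import Literature.MathematicalPhysics.KineticTheory.HardSphereEuler
import Literature.MathematicalPhysics.KineticTheory.HardSphereEulerProofs
import Summits.AtomisticToContinuum.HydrodynamicLimit.Theorems.OneFlightGossipEngineOneFlightLayeredChaosFirstFlightGhostInput
import HarnessLib

/-!
# `OneFlightGossipEngine.OneFlightLayeredChaos` — measurability of the entrance time of two free flights
(crux stmt-AtomisticToContinuum-14535, line `Sketch`, lead c4 wave 2; a brick of the first-rung transfer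
`TwoDirectionGhostInput → FirstFlightGhostInput`; registered stub `measurable_freeEntranceTime`).

The entrance time `t⋆ z = freeEntranceTime ε z i j = sInf {t > 0 | ‖sepVec (x_i + t v_i) (x_j + t v_j)‖ ≤ ε}` (junk `0`
when the set is empty) of the two free flights of `i` and `j` issued from a configuration `z` of `n` labelled spheres on
`𝕋³` is a MEASURABLE function of `z` on the whole configuration space `Config n (Fin 3) T3` (so far it was only known to
be measurable on the good set of an `(N+1)`-body flow, through collision records).

Proof.  The minimal-image distance `f (t, z) := ‖sepVec (x_i + t v_i) (x_j + t v_j)‖` is JOINTLY continuous in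
`(t, z)` (`continuous_norm_sepVec_freeFlight_uncurry`).  Hence for every compact time interval `[a, b]` the event
`{z | ∃ t ∈ [a, b], f (t, z) ≤ e}` is CLOSED — it is the projection along the compact factor `[a, b]` of a closed subset
of `[a, b] × Config` (`isClosedMap_snd_of_compactSpace`) —, in particular measurable
(`isClosed_setOf_exists_Icc_le`).  Finally `t⋆ z < c` is a countable Boolean combination of such events
(`sInf_setOf_pos_le_lt_iff`, pure order theory on `ℝ`: either the set is empty and `0 < c`, or it has an element in
`[1/(k+1), c - 1/(k+1)]` for some `k : ℕ`), and `measurable_of_Iio` concludes.  No dynamics enters.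
-/

open scoped Topology
open MeasureTheory Set Filter
open Literature.Analysis.FluidPDE Literature.MathematicalPhysics.KineticTheory
open Summit.AtomisticToContinuum.HydrodynamicLimit.Theorems

namespace Summit.AtomisticToContinuum.HydrodynamicLimit.Theorems.OLC

noncomputable section

/-! ## Order theory of the entrance-time functional `sInf {t > 0 | g t ≤ e}` -/

section Order

/-- **The entrance-time functional below a level.** For any `g : ℝ → ℝ` and levels `e`, `c`:
`sInf {t > 0 | g t ≤ e} < c` iff EITHER the set is empty (no `t` in any `[1/(k+1), k+1]` with `g t ≤ e`) and `0 < c`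
(junk value `sInf ∅ = 0`), OR some `t ∈ [1/(k+1), c - 1/(k+1)]`, `k : ℕ`, has `g t ≤ e` (the set is bounded below
by `0`, `csInf_lt_iff`, Archimedes).  A countable description used for measurability in parameters. [folklore] -/
theorem sInf_setOf_pos_le_lt_iff {g : ℝ → ℝ} {e c : ℝ} :
    sInf {t : ℝ | 0 < t ∧ g t ≤ e} < c ↔
      (0 < c ∧ ∀ k : ℕ, ¬ ∃ t ∈ Icc (1 / ((k : ℝ) + 1)) ((k : ℝ) + 1), g t ≤ e) ∨
        ∃ k : ℕ, ∃ t ∈ Icc (1 / ((k : ℝ) + 1)) (c - 1 / ((k : ℝ) + 1)), g t ≤ e := by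
  set S : Set ℝ := {t : ℝ | 0 < t ∧ g t ≤ e} with hS
  have hbdd : BddBelow S := ⟨0, fun t ht => ht.1.le⟩
  constructor
  · intro h
    rcases S.eq_empty_or_nonempty with hemp | hne
    · refine Or.inl ⟨?_, fun k => ?_⟩
      · rwa [hemp, Real.sInf_empty] at h
      · rintro ⟨t, ht, hgt⟩
        have htS : t ∈ S := ⟨Nat.one_div_pos_of_nat.trans_le ht.1, hgt⟩
        rw [hemp] at htS
        exact htS
    · obtain ⟨t, htS, htc⟩ := (csInf_lt_iff hbdd hne).1 h
      obtain ⟨k, hk⟩ := exists_nat_one_div_lt (lt_min htS.1 (sub_pos.2 htc))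
      refine Or.inr ⟨k, t, ⟨(hk.trans_le (min_le_left _ _)).le, ?_⟩, htS.2⟩
      have hk' := hk.trans_le (min_le_right _ _)
      linarith
  · rintro (⟨hc, hall⟩ | ⟨k, t, ht, hgt⟩)
    · have hemp : S = ∅ := by
        refine Set.eq_empty_of_forall_notMem fun t htS => ?_
        obtain ⟨k, hk⟩ := exists_nat_one_div_lt (lt_min htS.1 (one_div_pos.2 htS.1))
        refine hall k ⟨t, ⟨(hk.trans_le (min_le_left _ _)).le, ?_⟩, htS.2⟩
        exact (lt_of_one_div_lt_one_div (by positivity) (hk.trans_le (min_le_right _ _))).le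
      rw [hemp, Real.sInf_empty]
      exact hc
    · have hpos : (0 : ℝ) < 1 / ((k : ℝ) + 1) := Nat.one_div_pos_of_nat
      have htS : t ∈ S := ⟨hpos.trans_le ht.1, hgt⟩
      calc sInf S ≤ t := csInf_le hbdd htS
        _ ≤ c - 1 / ((k : ℝ) + 1) := ht.2
        _ < c := sub_lt_self c hpos

end Order

/-! ## Projection along a compact time interval -/

section Closed

variable {Z : Type*} [TopologicalSpace Z]

/-- **Hitting a closed sublevel during a compact time interval is a closed condition.** For a jointly continuous
`F : ℝ × Z → ℝ` and reals `a b e`, the set `{z | ∃ t ∈ [a, b], F (t, z) ≤ e}` is closed: it is the image under the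
second projection `[a, b] × Z → Z` — a closed map, `[a, b]` being compact (`isClosedMap_snd_of_compactSpace`) — of
the closed set `{(t, z) | F (t, z) ≤ e}`. [folklore] -/
theorem isClosed_setOf_exists_Icc_le {F : ℝ × Z → ℝ} (hF : Continuous F) (a b e : ℝ) :
    IsClosed {z : Z | ∃ t ∈ Icc a b, F (t, z) ≤ e} := by
  have hC : IsClosed {p : Icc a b × Z | F ((p.1 : ℝ), p.2) ≤ e} :=
    isClosed_le (hF.comp ((continuous_subtype_val.comp continuous_fst).prodMk continuous_snd)) continuous_const
  have himg := isClosedMap_snd_of_compactSpace _ hC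
  convert himg using 1
  ext z
  simp only [mem_setOf_eq, mem_image, Prod.exists, Subtype.exists, exists_eq_right, exists_prop]

end Closed

/-! ## The entrance time of two free flights is measurable -/

section Entrance

variable {n : ℕ}

/-- The minimal-image distance of the two free flights `x_i + t v_i`, `x_j + t v_j` is JOINTLY continuous in the time
and the configuration (`proj : ℝ³ → 𝕋³` and the minimal-image distance `Torus.euclidDist` are continuous). [folklore] -/
theorem continuous_norm_sepVec_freeFlight_uncurry (i j : Fin n) :
    Continuous fun p : ℝ × Config n (Fin 3) T3 =>
      ‖(Torus.geometry (Fin 3)).sepVec (freeFlight (Torus.geometry (Fin 3)) p.1 p.2 i).1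
        (freeFlight (Torus.geometry (Fin 3)) p.1 p.2 j).1‖ := by
  have h : ∀ k : Fin n, Continuous fun p : ℝ × Config n (Fin 3) T3 =>
      (freeFlight (Torus.geometry (Fin 3)) p.1 p.2 k).1 := fun k => by
    simp only [freeFlight_apply, Torus.geometry_translate]
    have hk : Continuous fun p : ℝ × Config n (Fin 3) T3 => p.2 k := (continuous_apply k).comp continuous_snd
    exact hk.fst.add (Literature.Analysis.FunctionSpaces.Torus.continuous_proj.comp (continuous_fst.smul hk.snd))
  simp only [Torus.norm_geometry_sepVec]
  simpa only [Function.comp_def] using Torus.continuous_euclidDist.comp ((h i).prodMk (h j))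

/-- **The entrance time of two free flights is measurable (registered stub `measurable_freeEntranceTime`).** For all
`n`, `ε`, `i`, `j`, the entrance time `z ↦ freeEntranceTime ε z i j = sInf {t > 0 | ‖sepVec (x_i + t v_i) (x_j + t v_j)‖
≤ ε}` (junk `0` when empty) is a measurable function on the configuration space `Config n (Fin 3) T3`: the sublevel
events `{t⋆ < c}` are countable Boolean combinations (`sInf_setOf_pos_le_lt_iff`) of the closed events
`{z | ∃ t ∈ [a, b], ‖sepVec (x_i + t v_i) (x_j + t v_j)‖ ≤ ε}` (`isClosed_setOf_exists_Icc_le`, joint continuity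
`continuous_norm_sepVec_freeFlight_uncurry`). [folklore] -/
theorem measurable_freeEntranceTime : ∀ {n : ℕ} (ε : ℝ) (i j : Fin n), Measurable fun z : Literature.Analysis.FluidPDE.Config n (Fin 3) Literature.MathematicalPhysics.KineticTheory.T3 => Summit.AtomisticToContinuum.HydrodynamicLimit.Theorems.OLC.freeEntranceTime ε z i j := by
  intro n ε i j
  set F : ℝ × Config n (Fin 3) T3 → ℝ := fun p =>
    ‖(Torus.geometry (Fin 3)).sepVec (freeFlight (Torus.geometry (Fin 3)) p.1 p.2 i).1
      (freeFlight (Torus.geometry (Fin 3)) p.1 p.2 j).1‖ with hFdef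
  have hF : Continuous F := continuous_norm_sepVec_freeFlight_uncurry i j
  have hE : ∀ a b : ℝ, MeasurableSet {z : Config n (Fin 3) T3 | ∃ t ∈ Icc a b, F (t, z) ≤ ε} := fun a b =>
    (isClosed_setOf_exists_Icc_le hF a b ε).measurableSet
  have hEc : ∀ a b : ℝ, MeasurableSet {z : Config n (Fin 3) T3 | ¬ ∃ t ∈ Icc a b, F (t, z) ≤ ε} := fun a b => by
    rw [← Set.compl_setOf]
    exact (hE a b).compl
  refine measurable_of_Iio fun c => ?_
  have hset : (fun z : Config n (Fin 3) T3 => freeEntranceTime ε z i j) ⁻¹' Iio c =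
      {z | (0 < c ∧ ∀ k : ℕ, ¬ ∃ t ∈ Icc (1 / ((k : ℝ) + 1)) ((k : ℝ) + 1), F (t, z) ≤ ε) ∨
        ∃ k : ℕ, ∃ t ∈ Icc (1 / ((k : ℝ) + 1)) (c - 1 / ((k : ℝ) + 1)), F (t, z) ≤ ε} := by
    ext z
    simp only [mem_preimage, mem_Iio, mem_setOf_eq, freeEntranceTime, hFdef]
    exact sInf_setOf_pos_le_lt_iff
  rw [hset, Set.setOf_or, Set.setOf_and, Set.setOf_forall, Set.setOf_exists]
  exact ((MeasurableSet.const _).inter (MeasurableSet.iInter fun k => hEc _ _)).union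
    (MeasurableSet.iUnion fun k => hE _ _)

end Entrance

end

end Summit.AtomisticToContinuum.HydrodynamicLimit.Theorems.OLC
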